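import Literature.MathematicalPhysics.QuantumFieldTheory.ConformalBootstrap3D.PointKernelK34v2Data
import Literature.MathematicalPhysics.QuantumFieldTheory.ConformalBootstrap3D.PointKernelParts

/-!
# K34v2 certificate, kernel part file P33: one-cell head segments 146, 147 in level ranges

The head cells whose kernel evaluation exceeds one `decide` are one-cell segments of `hsegsK34v2`; each is
checked by `PCert.hPartSideOK` (side conditions) and `PCert.hPartOK` per level range `[n_lo, n_lo + count)`
against an integer claim, the claims summing to `≥ 0` (`PointKernel.partsOK`); soundness is
`PCert.hParts_sound` (`PointKernelParts`).  The part files `P1, P2, …` are mutually independent (each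
imports only the data file); the ranges of one cell may span several of them, and the per-cell
conclusions `hparts_i` / `hcell_i` of those cells are assembled in `PointKernelK34v2.lean`.
Estimated kernel time 242 s.
-/

set_option maxRecDepth 100000
set_option maxHeartbeats 0

namespace Literature.MathematicalPhysics.QuantumFieldTheory.ConformalBootstrap3D.PointKernelK34v2

open Literature.MathematicalPhysics.QuantumFieldTheory.ConformalBootstrap3D.PointKernel

/-- levels `[68, 71)` of segment 146: partial lower sum `≥` claim. [folklore] -/
theorem part_146_8 : certK34v2.hPartOK (PCert.segAt hsegsK34v2 146) JHK34v2 68 3 (120538191319692114465236480218706739) = true := by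
  decide +kernel

/-- levels `[71, 73)` of segment 146: partial lower sum `≥` claim. [folklore] -/
theorem part_146_9 : certK34v2.hPartOK (PCert.segAt hsegsK34v2 146) JHK34v2 71 2 (53125825205224777881785568556866201) = true := by
  decide +kernel

/-- one-cell segment 147 (row 6, cell `[14341/2048, 7171/1024]`, chord, `n_F = 72`,
10 level ranges): side conditions. [folklore] -/
theorem pside_147 : certK34v2.hPartSideOK (PCert.segAt hsegsK34v2 147) JHK34v2 = true := by
  decide +kernel

/-- its level ranges `(n_lo, count, claim)`. [folklore] -/
def parts_147 : List (ℕ × ℕ × ℤ) := [(0, 25, -42914575400637348366420834100202365619), (25, 11, 27378316121574136787727680411816077813), (36, 8, 9140732916525091209548644419946377092), (44, 6, 3288170355058184483301049045338218122), (50, 5, 1486946368864060889798217037493773958), (55, 5, 843418590189831154722264162734538797), (60, 4, 391582671718555218321467519435364437), (64, 4, 239670847696041959114225152706878475), (68, 3, 106585925666721035644048259645461918), (71, 2, 39151603344725628243238091085675016)]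

/-- the ranges tile `[0, n_F]` and the claims sum to `≥ 0`. [folklore] -/
theorem pcov_147 : PointKernel.partsOK 72 parts_147 = true := by
  decide +kernel

/-- levels `[0, 25)` of segment 147: partial lower sum `≥` claim. [folklore] -/
theorem part_147_0 : certK34v2.hPartOK (PCert.segAt hsegsK34v2 147) JHK34v2 0 25 (-42914575400637348366420834100202365619) = true := by
  decide +kernel

/-- levels `[25, 36)` of segment 147: partial lower sum `≥` claim. [folklore] -/
theorem part_147_1 : certK34v2.hPartOK (PCert.segAt hsegsK34v2 147) JHK34v2 25 11 (27378316121574136787727680411816077813) = true := by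
  decide +kernel

end Literature.MathematicalPhysics.QuantumFieldTheory.ConformalBootstrap3D.PointKernelK34v2
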